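import Literature.NumberTheory.EllipticCurves.ModularSymbolsManin
import Literature.NumberTheory.EllipticCurves.ModularCurveGamma0IndexProofs
import Literature.NumberTheory.Automorphic.PopaZagierHeckeCompatibility
import HarnessLib

/-!
# `SL₂(ℤ)/Γ₀(N) ≅ ℙ¹(ℤ/Nℤ)` and the right action of integer matrices of determinant prime to `N`

Theorems and definitions with bodies only (D-0026). The M-symbols of the tree are indexed by
`Gamma0Coset N = SL₂(ℤ) ⧸ Γ₀(N)` (left cosets `gΓ₀(N)`, standing for `Γ₀(N)g⁻¹`,
`ModularSymbolsManin`). This file supplies the classical model (Cremona 1997, Prop. 2.2.2;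
Manin 1972, Prop. 1.2):

* `UniCol N` — unimodular columns `(a, c)ᵀ ∈ (ℤ/Nℤ)²`, and `P1 N = ℙ¹(ℤ/Nℤ)`, their classes
  modulo `(ℤ/Nℤ)ˣ`; `UniCol.exists_smul_eq_iff`: two unimodular columns are proportional by a
  unit iff `a c' = c a'` (over any commutative ring);
* `colP N g = [first column of g mod N]`, `colP_eq_colP_iff : colP g = colP g' ↔ g⁻¹ g' ∈ Γ₀(N)`,
  whence the bijection `cosetEquivP1 N : Gamma0Coset N ≃ P1 N` (surjectivity from
  `specialLinearGroup_map_surjective`, Shimura Lemma 1.38);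
* `smulP1 N B` — the action `[v] ↦ [B̄ v]` on `ℙ¹(ℤ/Nℤ)` of an integer matrix `B` with
  `det B` prime to `N`, and its transport `actP N : Gamma0Coset N → M₂(ℤ) → Gamma0Coset N`,
  `actP N q B = [adj B]·q`, a right action (`cosetAction_actP`: an instance of the abstract
  `CosetAction` of `PopaZagierHeckeCompatibility`) extending `actP N q γ = γ⁻¹ • q` for
  `γ ∈ SL₂(ℤ)` (`actP_coe`); this is the action through which the Hecke operators
  `∑ ξ(M) [y adj M]` of Merel and Popa–Zagier act on M-symbols for `(n, N) = 1`.

## References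

* [CremonaAlgorithms1997] J. E. Cremona, *Algorithms for modular elliptic curves*, §2.2,
  Prop. 2.2.2.
* Ju. I. Manin, *Parabolic points and zeta functions of modular curves* (1972), Prop. 1.2, §1.7.
* [PopaZagier2017] A. A. Popa, D. Zagier, §5 (induced module `ℚ[Γ₀(N) \ Γ₁]`).
-/

noncomputable section

open scoped MatrixGroups

open Matrix CongruenceSubgroup

namespace Literature.NumberTheory.EllipticCurves.ModularForms

variable (N : ℕ)

/-! ### Unimodular columns and `ℙ¹(ℤ/Nℤ)` -/

/-- Unimodular columns `(a, c)ᵀ` modulo `N`: `(a, c) = ℤ/Nℤ`. [cite: CremonaAlgorithms1997, §2.2] -/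
def UniCol : Type := {v : Fin 2 → ZMod N // IsCoprime (v 0) (v 1)}

namespace UniCol

variable {N}

/-- Scaling a unimodular column by a unit keeps it unimodular. [folklore] -/
theorem isCoprime_smul (u : (ZMod N)ˣ) {v : Fin 2 → ZMod N} (h : IsCoprime (v 0) (v 1)) :
    IsCoprime ((u • v) 0) ((u • v) 1) := by
  obtain ⟨a, b, hab⟩ := h
  refine ⟨a * ↑u⁻¹, b * ↑u⁻¹, ?_⟩
  simp only [Pi.smul_apply, Units.smul_def, smul_eq_mul]
  calc a * ↑u⁻¹ * (↑u * v 0) + b * ↑u⁻¹ * (↑u * v 1)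
      = (a * v 0 + b * v 1) * (↑u⁻¹ * ↑u) := by ring
    _ = 1 := by rw [hab, Units.inv_mul, mul_one]

/-- Units scale unimodular columns. [folklore] -/
instance : SMul (ZMod N)ˣ (UniCol N) := ⟨fun u v => ⟨u • v.1, isCoprime_smul u v.2⟩⟩

/-- Unfolding the scaling action. [folklore] -/
@[simp] theorem coe_smul (u : (ZMod N)ˣ) (v : UniCol N) : (u • v).1 = u • v.1 := rfl

/-- The scaling action of `(ℤ/Nℤ)ˣ` on unimodular columns. [folklore] -/
instance : MulAction (ZMod N)ˣ (UniCol N) where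
  one_smul v := Subtype.ext (one_smul _ v.1)
  mul_smul u u' v := Subtype.ext (mul_smul u u' v.1)

/-- **Two unimodular columns are proportional by a unit iff their determinant vanishes**
(over any commutative ring: the ratio `u = a a' + b c'` for `a a₀ + b c₀ = 1` is forced to be a
unit by unimodularity of the other column). [cite: CremonaAlgorithms1997, Prop. 2.2.2] -/
theorem exists_smul_eq_iff (v w : UniCol N) :
    (∃ u : (ZMod N)ˣ, u • v = w) ↔ v.1 0 * w.1 1 = v.1 1 * w.1 0 := by
  constructor
  · rintro ⟨u, rfl⟩
    simp only [coe_smul, Pi.smul_apply, Units.smul_def, smul_eq_mul]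
    ring
  · intro h
    obtain ⟨a, b, hab⟩ := v.2
    obtain ⟨a', b', hab'⟩ := w.2
    -- the ratio and its inverse
    set u : ZMod N := a * w.1 0 + b * w.1 1 with hu
    set u' : ZMod N := a' * v.1 0 + b' * v.1 1 with hu'
    have h0 : u * v.1 0 = w.1 0 := by rw [hu]; linear_combination w.1 0 * hab + b * h
    have h1 : u * v.1 1 = w.1 1 := by rw [hu]; linear_combination w.1 1 * hab - a * h
    have h0' : u' * w.1 0 = v.1 0 := by rw [hu']; linear_combination v.1 0 * hab' - b' * h
    have h1' : u' * w.1 1 = v.1 1 := by rw [hu']; linear_combination v.1 1 * hab' + a' * h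
    have huu : u * u' = 1 := by
      have e0 : (1 - u * u') * w.1 0 = 0 := by linear_combination -u * h0' - h0
      have e1 : (1 - u * u') * w.1 1 = 0 := by linear_combination -u * h1' - h1
      linear_combination (-1 : ZMod N) * (a' * e0 + b' * e1) + (1 - u * u') * hab'
    refine ⟨⟨u, u', huu, by rw [mul_comm]; exact huu⟩, Subtype.ext ?_⟩
    ext i
    fin_cases i
    · simpa using h0
    · simpa using h1

end UniCol

/-- `ℙ¹(ℤ/Nℤ)`: unimodular columns modulo units. [cite: CremonaAlgorithms1997, §2.2] -/
def P1 : Type := MulAction.orbitRel.Quotient (ZMod N)ˣ (UniCol N)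

namespace P1

variable {N}

/-- The class of a unimodular column. [folklore] -/
def mk (v : UniCol N) : P1 N := Quotient.mk (MulAction.orbitRel (ZMod N)ˣ (UniCol N)) v

/-- Every point of `ℙ¹(ℤ/Nℤ)` is a class. [folklore] -/
theorem mk_surjective : Function.Surjective (mk : UniCol N → P1 N) := Quotient.mk_surjective

/-- Equality of classes. [folklore] -/
theorem mk_eq_mk_iff (v w : UniCol N) : mk v = mk w ↔ v.1 0 * w.1 1 = v.1 1 * w.1 0 := by
  constructor
  · intro h
    have h' : v ∈ MulAction.orbit (ZMod N)ˣ w := MulAction.orbitRel_apply.mp (Quotient.exact h)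
    obtain ⟨u, hu⟩ := MulAction.mem_orbit_iff.mp h'
    have := (UniCol.exists_smul_eq_iff w v).mp ⟨u, hu⟩
    linear_combination -this
  · intro h
    obtain ⟨u, hu⟩ := (UniCol.exists_smul_eq_iff w v).mpr (by linear_combination -h)
    exact Quotient.sound (MulAction.orbitRel_apply.mpr (MulAction.mem_orbit_iff.mpr ⟨u, hu⟩))

/-- An induction principle for `ℙ¹(ℤ/Nℤ)`. [folklore] -/
theorem ind {p : P1 N → Prop} (h : ∀ v, p (mk v)) (x : P1 N) : p x := Quotient.ind h x

end P1

/-! ### First columns of `SL₂(ℤ)` modulo `N` -/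

/-- The first column of `g ∈ SL₂(ℤ)` modulo `N`, a unimodular column. [folklore] -/
def firstCol (g : SL(2, ℤ)) : UniCol N :=
  ⟨![((g 0 0 : ℤ) : ZMod N), ((g 1 0 : ℤ) : ZMod N)], by
    have hdet := g.det_coe
    rw [Matrix.det_fin_two] at hdet
    refine ⟨((g 1 1 : ℤ) : ZMod N), -((g 0 1 : ℤ) : ZMod N), ?_⟩
    simp only [Matrix.cons_val_zero, Matrix.cons_val_one, Matrix.cons_val_fin_one]
    have := congrArg (fun x : ℤ => (x : ZMod N)) hdet
    push_cast at this
    linear_combination this⟩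

/-- `colP N g = [first column of g] ∈ ℙ¹(ℤ/Nℤ)`. [cite: CremonaAlgorithms1997, Prop. 2.2.2] -/
def colP (g : SL(2, ℤ)) : P1 N := P1.mk (firstCol N g)

/-- Entries of `firstCol`. [folklore] -/
@[simp] theorem firstCol_apply_zero (g : SL(2, ℤ)) :
    (firstCol N g).1 0 = ((g 0 0 : ℤ) : ZMod N) := rfl

/-- Entries of `firstCol`. [folklore] -/
@[simp] theorem firstCol_apply_one (g : SL(2, ℤ)) :
    (firstCol N g).1 1 = ((g 1 0 : ℤ) : ZMod N) := rfl

/-- **`[col g] = [col g']` in `ℙ¹(ℤ/Nℤ)` iff `g⁻¹ g' ∈ Γ₀(N)`** (the bottom-left entry of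
`g⁻¹ g'` is `a c' - c a'`). [cite: CremonaAlgorithms1997, Prop. 2.2.2] -/
theorem colP_eq_colP_iff (g g' : SL(2, ℤ)) : colP N g = colP N g' ↔ g⁻¹ * g' ∈ Gamma0 N := by
  rw [colP, colP, P1.mk_eq_mk_iff, Gamma0_mem]
  simp only [firstCol_apply_zero, firstCol_apply_one]
  have h10 : ((g⁻¹ * g') 1 0 : ℤ) = -(g 1 0 : ℤ) * g' 0 0 + g 0 0 * g' 1 0 := by
    rw [Matrix.SpecialLinearGroup.coe_mul, Matrix.SpecialLinearGroup.coe_inv,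
      Matrix.adjugate_fin_two]
    simp [Matrix.mul_apply, Fin.sum_univ_two]
  rw [h10]
  push_cast
  constructor <;> intro h <;> linear_combination h

/-! ### The action of integer matrices of determinant prime to `N` on `ℙ¹(ℤ/Nℤ)` -/

/-- Reduction of an integer matrix modulo `N`. [folklore] -/
def redMat (B : Matrix (Fin 2) (Fin 2) ℤ) : Matrix (Fin 2) (Fin 2) (ZMod N) :=
  (Int.castRingHom (ZMod N)).mapMatrix B

/-- Entries of the reduction. [folklore] -/
@[simp] theorem redMat_apply (B : Matrix (Fin 2) (Fin 2) ℤ) (i j : Fin 2) :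
    redMat N B i j = ((B i j : ℤ) : ZMod N) := rfl

/-- `det (B mod N) = det B mod N`. [folklore] -/
theorem det_redMat (B : Matrix (Fin 2) (Fin 2) ℤ) : (redMat N B).det = ((B.det : ℤ) : ZMod N) := by
  rw [redMat, ← RingHom.map_det]; rfl

/-- Reduction is multiplicative. [folklore] -/
theorem redMat_mul (B B' : Matrix (Fin 2) (Fin 2) ℤ) :
    redMat N (B * B') = redMat N B * redMat N B' := by
  simp only [redMat, map_mul]

/-- A matrix with unit determinant preserves unimodularity. [folklore] -/
theorem isCoprime_mulVec {A : Matrix (Fin 2) (Fin 2) (ZMod N)} (hA : IsUnit A.det)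
    {v : Fin 2 → ZMod N} (hv : IsCoprime (v 0) (v 1)) :
    IsCoprime ((A *ᵥ v) 0) ((A *ᵥ v) 1) := by
  obtain ⟨a, b, hab⟩ := hv
  obtain ⟨u, hu⟩ := hA
  -- coefficients `u⁻¹ (a, b) adj A`
  set r : Fin 2 → ZMod N := ![a, b] with hr
  set r' : Fin 2 → ZMod N := (↑u⁻¹ : ZMod N) • (r ᵥ* adjugate A) with hr'def
  have hr' : r' ᵥ* A = r := by
    rw [hr'def, Matrix.smul_vecMul, Matrix.vecMul_vecMul, Matrix.adjugate_mul, ← hu,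
      Matrix.vecMul_smul, Matrix.vecMul_one, smul_smul, Units.inv_mul, one_smul]
  refine ⟨r' 0, r' 1, ?_⟩
  have key : r' ⬝ᵥ (A *ᵥ v) = 1 := by
    rw [Matrix.dotProduct_mulVec, hr']
    simp [hr, dotProduct, Fin.sum_univ_two, hab]
  simpa [dotProduct, Fin.sum_univ_two] using key

variable {N} in
/-- The action of a matrix with unit determinant on unimodular columns. [folklore] -/
def UniCol.mulVec {A : Matrix (Fin 2) (Fin 2) (ZMod N)} (hA : IsUnit A.det) (v : UniCol N) :
    UniCol N :=
  ⟨A *ᵥ v.1, isCoprime_mulVec N hA v.2⟩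

/-- **The action `[v] ↦ [B̄ v]` of an integer matrix `B` with `det B` prime to `N` on
`ℙ¹(ℤ/Nℤ)`** (the identity if `det B` is not a unit mod `N`). [cite: PopaZagier2017, §5] -/
def smulP1 (B : Matrix (Fin 2) (Fin 2) ℤ) : P1 N → P1 N :=
  haveI := Classical.dec (IsUnit (redMat N B).det)
  if hB : IsUnit (redMat N B).det then
    Quotient.map' (UniCol.mulVec hB) fun v w ⟨u, huv⟩ => ⟨u, by
      apply Subtype.ext
      simp only [UniCol.mulVec, UniCol.coe_smul, ← huv, Matrix.mulVec_smul]⟩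
  else id

/-- `smulP1` on a class. [folklore] -/
theorem smulP1_mk {B : Matrix (Fin 2) (Fin 2) ℤ} (hB : IsUnit (redMat N B).det) (v : UniCol N) :
    smulP1 N B (P1.mk v) = P1.mk (UniCol.mulVec hB v) := by
  rw [smulP1, dif_pos hB]
  rfl

/-- `IsUnit det` modulo `N`. [folklore] -/
theorem isUnit_det_redMat_iff (B : Matrix (Fin 2) (Fin 2) ℤ) :
    IsUnit (redMat N B).det ↔ IsUnit ((B.det : ℤ) : ZMod N) := by rw [det_redMat]

/-- `smulP1 (B B') = smulP1 B ∘ smulP1 B'`. [folklore] -/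
theorem smulP1_mul {B B' : Matrix (Fin 2) (Fin 2) ℤ} (hB : IsUnit ((B.det : ℤ) : ZMod N))
    (hB' : IsUnit ((B'.det : ℤ) : ZMod N)) (x : P1 N) :
    smulP1 N (B * B') x = smulP1 N B (smulP1 N B' x) := by
  have h1 : IsUnit (redMat N B).det := (isUnit_det_redMat_iff N B).mpr hB
  have h2 : IsUnit (redMat N B').det := (isUnit_det_redMat_iff N B').mpr hB'
  have h3 : IsUnit (redMat N (B * B')).det := by
    rw [isUnit_det_redMat_iff, Matrix.det_mul, Int.cast_mul]; exact hB.mul hB'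
  induction x using P1.ind with
  | h v =>
    rw [smulP1_mk N h3, smulP1_mk N h2, smulP1_mk N h1]
    congr 1
    apply Subtype.ext
    simp only [UniCol.mulVec, redMat_mul, Matrix.mulVec_mulVec]

/-- `smulP1 1 = id`. [folklore] -/
theorem smulP1_one (x : P1 N) : smulP1 N 1 x = x := by
  have h1 : IsUnit (redMat N 1).det := by simp [redMat]
  induction x using P1.ind with
  | h v =>
    rw [smulP1_mk N h1]
    congr 1
    apply Subtype.ext
    simp [UniCol.mulVec, redMat]

/-- `smulP1 (-B) = smulP1 B`: `-1` acts trivially on `ℙ¹`. [folklore] -/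
theorem smulP1_neg {B : Matrix (Fin 2) (Fin 2) ℤ} (hB : IsUnit ((B.det : ℤ) : ZMod N)) (x : P1 N) :
    smulP1 N (-B) x = smulP1 N B x := by
  have h1 : IsUnit (redMat N B).det := (isUnit_det_redMat_iff N B).mpr hB
  have h2 : IsUnit (redMat N (-B)).det := by
    rw [isUnit_det_redMat_iff, Matrix.det_neg]; simpa using hB
  induction x using P1.ind with
  | h v =>
    rw [smulP1_mk N h2, smulP1_mk N h1, P1.mk_eq_mk_iff]
    simp only [UniCol.mulVec, redMat, map_neg, Matrix.neg_mulVec, Pi.neg_apply]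
    ring

/-! ### The bijection `SL₂(ℤ)/Γ₀(N) ≅ ℙ¹(ℤ/Nℤ)` -/

variable [NeZero N]

/-- Every unimodular column modulo `N` is the first column of a matrix in `SL₂(ℤ)`
(surjectivity of `SL₂(ℤ) → SL₂(ℤ/Nℤ)`). [cite: ShimuraIATAF1971, Lemma 1.38] -/
theorem exists_firstCol_eq (v : UniCol N) : ∃ g : SL(2, ℤ), firstCol N g = v := by
  obtain ⟨a, b, hab⟩ := v.2
  let B : SL(2, ZMod N) := ⟨!![v.1 0, -b; v.1 1, a], by
    rw [Matrix.det_fin_two_of]; linear_combination hab⟩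
  obtain ⟨g, hg⟩ := specialLinearGroup_map_surjective N B
  refine ⟨g, Subtype.ext ?_⟩
  have h0 : ((g 0 0 : ℤ) : ZMod N) = v.1 0 := by
    have := congrArg (fun M : SL(2, ZMod N) => (M 0 0 : ZMod N)) hg
    simpa [B] using this
  have h1 : ((g 1 0 : ℤ) : ZMod N) = v.1 1 := by
    have := congrArg (fun M : SL(2, ZMod N) => (M 1 0 : ZMod N)) hg
    simpa [B] using this
  ext i
  fin_cases i
  · simpa using h0
  · simpa using h1

/-- `colP` is onto. [folklore] -/
theorem colP_surjective : Function.Surjective (colP N) := by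
  intro x
  induction x using P1.ind with
  | h v =>
    obtain ⟨g, hg⟩ := exists_firstCol_eq N v
    exact ⟨g, by rw [colP, hg]⟩

/-- The map `gΓ₀(N) ↦ [col g]`. [folklore] -/
def cosetToP1 : Gamma0Coset N → P1 N :=
  Quotient.lift (colP N) fun g g' h =>
    (colP_eq_colP_iff N g g').mpr (QuotientGroup.leftRel_apply.mp h)

omit [NeZero N] in
/-- `cosetToP1` on a representative. [folklore] -/
@[simp] theorem cosetToP1_mk (g : SL(2, ℤ)) : cosetToP1 N (g : Gamma0Coset N) = colP N g := rfl

/-- **`SL₂(ℤ)/Γ₀(N) ≅ ℙ¹(ℤ/Nℤ)`**, `gΓ₀(N) ↦ [first column of g]`.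
[cite: CremonaAlgorithms1997, Prop. 2.2.2] -/
def cosetEquivP1 : Gamma0Coset N ≃ P1 N :=
  Equiv.ofBijective (cosetToP1 N) ⟨by
    intro q q' h
    induction q using QuotientGroup.induction_on with
    | H g =>
      induction q' using QuotientGroup.induction_on with
      | H g' =>
        rw [cosetToP1_mk, cosetToP1_mk, colP_eq_colP_iff] at h
        exact QuotientGroup.eq.mpr h, by
    intro x
    obtain ⟨g, hg⟩ := colP_surjective N x
    exact ⟨g, hg⟩⟩

/-- `cosetEquivP1` on a representative. [folklore] -/
@[simp] theorem cosetEquivP1_mk (g : SL(2, ℤ)) : cosetEquivP1 N (g : Gamma0Coset N) = colP N g :=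
  rfl

/-! ### Transport to `Gamma0Coset N` and the `CosetAction` axioms -/

/-- **The right action of integer matrices with determinant prime to `N` on `SL₂(ℤ)/Γ₀(N)`**:
`actP N q B = [adj B] · q` under `SL₂(ℤ)/Γ₀(N) ≅ ℙ¹(ℤ/Nℤ)` (so that `actP N q (adj M) = [M̄] · q`
and `actP N q γ = γ⁻¹ • q` for `γ ∈ SL₂(ℤ)`). [cite: PopaZagier2017, §5] -/
def actP (q : Gamma0Coset N) (B : Matrix (Fin 2) (Fin 2) ℤ) : Gamma0Coset N :=
  (cosetEquivP1 N).symm (smulP1 N (adjugate B) (cosetEquivP1 N q))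

/-- `actP` under the bijection with `ℙ¹`. [folklore] -/
theorem cosetEquivP1_actP (q : Gamma0Coset N) (B : Matrix (Fin 2) (Fin 2) ℤ) :
    cosetEquivP1 N (actP N q B) = smulP1 N (adjugate B) (cosetEquivP1 N q) := by
  simp [actP]

omit [NeZero N] in
/-- `adj (-B) = -adj B` for `2 × 2` matrices. [folklore] -/
theorem adjugate_neg_two (B : Matrix (Fin 2) (Fin 2) ℤ) : adjugate (-B) = -adjugate B := by
  rw [Matrix.adjugate_fin_two, Matrix.adjugate_fin_two]
  ext i j; fin_cases i <;> fin_cases j <;> simp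

open Literature.NumberTheory.Automorphic.PopaZagier in
/-- **`actP` is a `CosetAction`** for the matrices with determinant prime to `N`
(`PopaZagierHeckeCompatibility.CosetAction`). [cite: PopaZagier2017, §5] -/
theorem cosetAction_actP :
    CosetAction (fun B : Mat => IsUnit ((B.det : ℤ) : ZMod N)) (actP N) where
  mul hB hB' := by rw [Matrix.det_mul, Int.cast_mul]; exact hB.mul hB'
  neg hB := by rw [Matrix.det_neg]; simpa using hB
  adj hB := by rw [Matrix.det_adjugate]; simpa using hB
  of_det hB := by rw [hB]; simp
  act_one q := by
    apply (cosetEquivP1 N).injective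
    rw [cosetEquivP1_actP, Matrix.adjugate_one, smulP1_one]
  act_mul q B B' hB hB' := by
    apply (cosetEquivP1 N).injective
    have hBa : IsUnit (((adjugate B).det : ℤ) : ZMod N) := by
      rw [Matrix.det_adjugate]; simpa using hB
    have hBa' : IsUnit (((adjugate B').det : ℤ) : ZMod N) := by
      rw [Matrix.det_adjugate]; simpa using hB'
    rw [cosetEquivP1_actP, cosetEquivP1_actP, cosetEquivP1_actP, Matrix.adjugate_mul_distrib]
    exact (smulP1_mul N hBa' hBa _).symm
  act_neg q B hB := by
    apply (cosetEquivP1 N).injective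
    have hBa : IsUnit (((adjugate B).det : ℤ) : ZMod N) := by
      rw [Matrix.det_adjugate]; simpa using hB
    rw [cosetEquivP1_actP, cosetEquivP1_actP, adjugate_neg_two]
    exact smulP1_neg N hBa _

/-- **On `SL₂(ℤ)` the action is the coset action**: `actP N q γ = γ⁻¹ • q`
(`[adj γ̄ · col g] = [col (γ⁻¹ g)]`). [cite: PopaZagier2017, §5] -/
theorem actP_coe (q : Gamma0Coset N) (γ : SL(2, ℤ)) :
    actP N q (γ : Matrix (Fin 2) (Fin 2) ℤ) = γ⁻¹ • q := by
  apply (cosetEquivP1 N).injective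
  rw [cosetEquivP1_actP]
  induction q using QuotientGroup.induction_on with
  | H g =>
    have hu : IsUnit (redMat N (adjugate (γ : Matrix (Fin 2) (Fin 2) ℤ))).det := by
      rw [isUnit_det_redMat_iff, Matrix.det_adjugate, γ.det_coe]; simp
    rw [show (γ⁻¹ • (g : Gamma0Coset N)) = ((γ⁻¹ * g : SL(2, ℤ)) : Gamma0Coset N) from rfl,
      cosetEquivP1_mk, cosetEquivP1_mk, colP, colP, smulP1_mk N hu]
    congr 1
    apply Subtype.ext
    simp only [UniCol.mulVec, firstCol]
    rw [Matrix.SpecialLinearGroup.coe_mul, Matrix.SpecialLinearGroup.coe_inv]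
    ext i
    fin_cases i <;>
      simp [redMat, Matrix.adjugate_fin_two, Matrix.mulVec, dotProduct, Fin.sum_univ_two,
        Matrix.mul_apply]

/-- **`actP N q (adj M)` in coordinates**: `[col (actP q (adj M))] = [M̄ · col g]` for `q = gΓ₀(N)`.
[folklore] -/
theorem cosetEquivP1_actP_adjugate (q : Gamma0Coset N) (M : Matrix (Fin 2) (Fin 2) ℤ) :
    cosetEquivP1 N (actP N q (adjugate M)) = smulP1 N M (cosetEquivP1 N q) := by
  rw [cosetEquivP1_actP, Matrix.adjugate_adjugate _ (by simp)]
  simp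

end Literature.NumberTheory.EllipticCurves.ModularForms
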